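import Summits.AtomisticToContinuum.Crystallization.Theses.ThreeConeCertificate
import Summits.AtomisticToContinuum.Crystallization.Theorems.SlackRigidity.Negative.WitnessBasics
import Summits.AtomisticToContinuum.Crystallization.Theorems.ExcessDecayLiouvilleCoarseGrainsTrialBound
import Literature.MathematicalPhysics.StatisticalMechanics.BarlowStacking
import Literature.MathematicalPhysics.StatisticalMechanics.MuGroundStateConfiguration
import Literature.MathematicalPhysics.StatisticalMechanics.LocalMatchingCompactness
import Literature.MathematicalPhysics.StatisticalMechanics.LennardJonesClusters
import Summits.AtomisticToContinuum.Crystallization.Theorems.ThreeConeCertificateSlackRigidityThinning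
import Summits.AtomisticToContinuum.Crystallization.Theorems.ThreeConeCertificateSlackRigidityLocalLimit
import Summits.AtomisticToContinuum.Crystallization.Theorems.ThreeConeCertificateSlackRigidityWitness
import Summits.AtomisticToContinuum.Crystallization.Theorems.ThreeConeCertificateSlackRigidityRooting

/-!
# Line `c-layer-witness-strictness` for crux `SlackRigidity` (stmt-AtomisticToContinuum-11960) — skeleton

Route `ThreeConeCertificate` (sub-problem `Crystallization`); crux decl
`Summit.AtomisticToContinuum.Crystallization.Theses.ThreeConeCertificate.SlackRigidity`
(readback `SlackRigidityNegative.slackRigidity_iff : SlackRigidity ↔ ∃ P, RigidFor P`, landed).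

IDEA (card `Cruxes/SlackRigidity/Ideas/c-layer-witness-strictness.md`, triage r1: 3 × pass).
Ask the exact three-cone certificate for STRICT COMPLEMENTARITY in its two LOCAL cones only —
(S1) the one-centre star functional `F` certifying `c(g)` vanishes only on LAYERED stars (its zero
set pins the radius-`6a/5` environment to a Barlow 12-star of the certificate's own `hcp(a,h)`
geometry), (S2) the slack `U` is strictly positive at the universal c-layer witness distance
`d* = √(16a²/3 + 4h²)` (`= 2√2·a` at the ideal ratio) — and prove the crux as the soft shadow of an
EXACT statement about infinite configurations: a `1/3`-separated rooted set all of whose stars are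
`F`-tight and all of whose pair distances are zeros of `U` is a linearly rotated copy of
`hcp(a,h)`.  The Bochner part `f` is spent on energy only and never localised.

STATUS (lead prover-line-stmt-AtomisticToContinuum-11960-0, 2026-08-16): of the seven registered stubs,
`stub_thinning` (p76575, `Theorems.CLayerWitnessThinning`), `stub_rooting` (p76711/p77189/p77330,
`Theorems.CLayerWitnessRooting`), `stub_localLimit` (p76619, `Theorems.CLayerWitnessLocalLimit`) and
`stub_witness` (p76653, `Theorems.CLayerWitnessWitness`) are LANDED sorry-free theorems and are
referenced below by name; `stub_layeringIdeal` / `stub_layeringOffIdeal` are in flight;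
`stub_strictCertificate` is the open C⁺ (⊇ crux 11959).

COMPOSITION (kernel-checked, `sorry` only inside the stubs not yet landed; the landed trial-state bound
`ExcessDecayLiouvilleCoarseGrains.stub_trialBound` is imported):
`stub_strictCertificate` (C⁺: ExactCertificate at `P = hcp(a,h)` + (S1) + (S2) + regularity) ⟶
fix `P := hcp(a,h)`; if `¬ RigidFor P` then `stub_rooting` (fed with `stub_thinning` and
`stub_trialBound`) produces a rooted sequence of `1/3`-separated recentred near-minimisers with bad
roots and vanishing local `(F,U)`-slack ⟶ `stub_localLimit` gives a ZERO-SLACK local limit `Y ∋ 0`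
not matched at its root ⟶ (S1) makes every star of `Y` layered ⟶ `stub_layeringOffIdeal` /
`stub_layeringIdeal` (relaxed / ideal-ratio Hales DSP §1.3; lead's reshape, 7 stubs) give `Y = A '' barlowStacking a h s` ⟶ `U = 0` on the pair distances of `Y` and
(S2) forbid the witness distance, so `stub_witness` gives `barlowStacking a h s = B '' hcpStacking a h`
⟶ `Y = (A ∘ B) '' P.points` IS matched at the root — contradiction.  Hence `RigidFor P`, i.e.
`SlackRigidity` BY NAME (`SlackRigidity_of`).

DISPROOF USED (`Cruxes/SlackRigidity/Disproof.lean`, cycle 1, NO KILL; landed copies under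
`Theorems/SlackRigidity/Negative/`): `not_rigidForWithoutEnergy` — the energy hypothesis is consumed
in `stub_rooting` (total `(F,U)`-slack `≤ excess + (E(N) − N·e(P)) = o(N)`) and in `stub_thinning`
(deletions are paid out of the excess); `not_rigidForWithoutRotations` — the isometry is PRODUCED
(`A` from `stub_layeringOffIdeal`/`stub_layeringIdeal`, `B` from `stub_witness`), never frozen; `zero_mem_points_of_rigidFor` /
`rigidFor_vertexTransitive` / `norm_le_of_mem_points_of_rigidFor` / `rigidFor_uniformlyDiscrete` —
the witness is `hcpPeriodicConfiguration` (`0 = barlowPos 0 0 0 ∈ P.points`, homogeneous by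
`hcpStacking_homogeneous`, uniformly discrete); `not_forall_rigidFor` — not engaged (`∃ P` only).
Negatives 3506 (multiplicity-blind matching on merely injective `x`) and 4146 (tolerant one-centre
rigidity at 1 %) are avoided: every matching/compactness statement below is over `1/3`-SEPARATED
sets (thinning first), and the only local-rigidity statements (`stub_layeringOffIdeal`, `stub_layeringIdeal`) are EXACT.
-/

noncomputable section

namespace Summit.AtomisticToContinuum.Crystallization.Cruxes.SlackRigidity.CLayerWitnessStrictness

open scoped BigOperators Topology
open Filter Set Metric
open Literature.MathematicalPhysics.StatisticalMechanics
open Summit.AtomisticToContinuum.Crystallization.Theses.ThreeConeCertificate (SlackRigidity ExactCertificate)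
open Summit.AtomisticToContinuum.Crystallization.Theorems.SlackRigidityNegative
  (E3 Good RigidFor ExcessVanishes BadFractionVanishes badCount slackRigidity_iff)
open Summit.AtomisticToContinuum.Crystallization.Theorems.ExcessDecayLiouvilleCoarseGrains (stub_trialBound)

/-! ## Stubs (registered obligations of the line)

Vocabulary used verbatim in the stub statements (tree declarations only, no line-local `def`):
* the **recentred `ρ'`-star** of `y` in `Y ⊆ ℝ³` is the set `((fun z => z - y) '' Y) ∩ closedBall 0 ρ'`
  (for a finite configuration `x`, `Y = Set.range x`, `y = x i`);
* **`1/3`-separated**: `∀ p ∈ Y, ∀ q ∈ Y, p ≠ q → 1/3 ≤ dist p q` (the tree's ground-state separation,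
  `LennardJonesMinimalDistance_holds`);
* **root-matched at `(R, ε)`** (the crux's two-way matching, recentred at the particle = `0`):
  `∃ A : E3 →ₗᵢ[ℝ] E3, (∀ p ∈ P.points, ‖p‖ ≤ R → ∃ q ∈ Y, dist q (A p) ≤ ε) ∧
   (∀ q ∈ Y, ‖q‖ ≤ R → ∃ p ∈ P.points, dist q (A p) ≤ ε)` — for `Y = (· - x i) '' range x` this is
  literally `Good P R ε x i`;
* `RigidFor P` (landed, `Theorems/SlackRigidity/Negative/WitnessBasics.lean`): the crux for the witness `P`. -/

/-- **Stub 1 — the STRICT star certificate (C⁺ of the card; XL / open: it contains crux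
`ExactCertificate` (stmt-11959) at `P = hcp(a,h)` and adds strict complementarity of the two LOCAL
cones).**  There are relaxed-hcp parameters `a, h > 0` with `h/a ∈ (0.775, 0.894)` (a window
containing the ideal `√(2/3) ≈ 0.8165` and the LJ optimum `c/a ≈ 1.63298`, free of the six
coincidence ratios `0.601, 0.645, 2/3, √(3/5), √(4/5), 0.957` of the witness distance), a split
`V_LJ = g + U + f` on `(0,∞)` with `U ≥ 0` continuous, `g ≡ 0` beyond `ρ`, `f` of positive type, a
constant `c` with `c + f(0)/2 = −e(hcp(a,h))`, and a ONE-CENTRE functional `F ≥ 0` of the recentred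
`ρ'`-star such that
(2) `Σ_i F(star_i) ≤ Σ_{i<j} g(r_ij) + cN` on every injective configuration (fair-share certification
of `c(g)`; with `F ≥ 0` this is the `g`-stability clause of `ExactCertificate`);
(3) `F` is uniformly continuous in the local matching topology on `1/3`-separated rooted sets
(soft cutoff at radius `ρ'`; triage r1-3 sharpening (3): separated sets only);
(S1) TIGHT STARS ARE LAYERED: on a `1/3`-separated rooted `T`, `F(T ∩ B̄_{ρ'}) = 0` forces
`T ∩ B̄_{6a/5}` to be a linearly rotated Barlow 12-star `barlowStacking a h s ∩ B̄_{6a/5}`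
(`s` Hägg; h- or c-centred — the WEAK form, triage r1 sharpenings (b)/(ii)/(2));
(S2) `U(√(16a²/3 + 4h²)) > 0` — strict slack at the c-layer witness distance (`∉ D_hcp(a,h)` on the
window; budget `3·U(d*) ≤ e(fcc(a,h)) − e(hcp(a,h)) ≈ 7·10⁻⁵`, only the SIGN is used).
Why plausibly true: Goldman–Tucker heuristics (strictness available iff hcp is the unique optimum);
why it might fail: the LP-optimal `F` may be degenerate (flat in a strain direction or at frustrated
stars — TetrahedralFrustration), or fcc's `7·10⁻⁵` may sit entirely in `f̂`.
[cite: CohnKumar2006 §9; Ruelle1969 Prop. 3.2.7; Hales2012 Thm 1; FlatleyTheil2015; Stillinger2001] -/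
theorem stub_strictCertificate :
    ∃ (a h : ℝ) (ha : 0 < a) (hh : 0 < h), 0.775 * a < h ∧ h < 0.894 * a ∧
    ∃ (ρ c ρ' : ℝ) (g U f : ℝ → ℝ) (F : Set E3 → ℝ),
      (∀ r : ℝ, 0 < r → lennardJones r = g r + U r + f r) ∧
      (∀ r : ℝ, 0 < r → 0 ≤ U r) ∧
      ContinuousOn U (Set.Ioi 0) ∧
      (∀ r : ℝ, ρ ≤ r → g r = 0) ∧
      (∀ (n : ℕ) (y : Fin n → E3) (w : Fin n → ℝ),
        0 ≤ ∑ i, ∑ j, w i * w j * f (dist (y i) (y j))) ∧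
      (∀ T : Set E3, 0 ≤ F T) ∧
      (∀ (N : ℕ) (x : Fin N → E3), Function.Injective x →
        ∑ i, F (((fun z => z - x i) '' Set.range x) ∩ Metric.closedBall 0 ρ') ≤
          interactionEnergy g x + c * N) ∧
      (∀ ε : ℝ, 0 < ε → ∃ η : ℝ, 0 < η ∧ ∀ S T : Set E3,
        (∀ p ∈ S, ∀ q ∈ S, p ≠ q → (1 / 3 : ℝ) ≤ dist p q) →
        (∀ p ∈ T, ∀ q ∈ T, p ≠ q → (1 / 3 : ℝ) ≤ dist p q) →
        (0 : E3) ∈ S → (0 : E3) ∈ T → BallMatch η (ρ' + 1) 0 S T →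
        |F (S ∩ Metric.closedBall 0 ρ') - F (T ∩ Metric.closedBall 0 ρ')| ≤ ε) ∧
      (∀ T : Set E3, (∀ p ∈ T, ∀ q ∈ T, p ≠ q → (1 / 3 : ℝ) ≤ dist p q) → (0 : E3) ∈ T →
        F (T ∩ Metric.closedBall 0 ρ') = 0 →
        ∃ s : ℤ → ℤ, IsHaggSeq s ∧ ∃ B : E3 →ₗᵢ[ℝ] E3,
          T ∩ Metric.closedBall 0 (6 * a / 5) =
            B '' (barlowStacking a h s ∩ Metric.closedBall 0 (6 * a / 5))) ∧
      0 < U (Real.sqrt (16 * a ^ 2 / 3 + 4 * h ^ 2)) ∧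
      c + f 0 / 2 = -((hcpPeriodicConfiguration ha.ne' hh.ne').energyPerParticle lennardJones) := by
  sorry

/-- **Stub 2 — thinning of near-minimisers (M; Lennard-Jones specific, certificate-free).**
There is `K > 0` (e.g. `K = 729·229/12 ≈ 1.39·10⁴`) such that every injective configuration `x`
of `N` points contains a `1/3`-SEPARATED sub-configuration `y` of `M ≤ N` of its points with no
larger energy and `K·(N − M) ≤ 𝓔(x) − E(N)`: the deletions are paid out of the EXCESS.  Proof:
while the minimal distance `r` is `< 1/3`, delete a particle of a closest pair — its site energy is
`≥ u(u − 500)/12 ≥ K` with `u = r⁻⁶ ≥ 729` (the tree's computation in the proof of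
`LennardJonesMinimalDistance_holds`, `sum_inv_pow_six_le`: at most `250 r⁻⁶` inverse-sixth-power
mass around a point of an `r`-separated set), so each deletion lowers the energy by `≥ K`; after `k`
deletions `𝓔(y) ≤ 𝓔(x) − kK` and `𝓔(y) ≥ E(N − k) ≥ E(N)` (`N ↦ E(N)` is non-increasing for LJ:
add a far-away particle). Used by `stub_rooting`. [cite: BlancLewin2015 §2.2; Xue1997] -/
theorem stub_thinning :
    ∃ K : ℝ, 0 < K ∧ ∀ (N : ℕ) (x : Fin N → E3), Function.Injective x →
      ∃ (M : ℕ) (y : Fin M → E3), Function.Injective y ∧ Set.range y ⊆ Set.range x ∧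
        (∀ i j : Fin M, i ≠ j → (1 / 3 : ℝ) ≤ dist (y i) (y j)) ∧ M ≤ N ∧
        K * ((N : ℝ) - M) ≤ interactionEnergy lennardJones x - groundStateEnergy lennardJones 3 N ∧
        interactionEnergy lennardJones y ≤ interactionEnergy lennardJones x :=
  Summit.AtomisticToContinuum.Crystallization.Theorems.CLayerWitnessThinning.stub_thinning

/-- **Stub 3 — rooting: from a failing witness to a rooted small-slack bad sequence (L; soft, valid
for ANY periodic `P` and any certificate data).**  Hypotheses: the thinning statement (Stub 2), the
split with `U ≥ 0` and `f` of positive type, star certification `Σ_i F(star_i) ≤ Σ g + cN` with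
`F ≥ 0`, the exact constant `c + f(0)/2 = −e(P)`, and the trial-state bound
`E(N) ≤ N(e(P) + η)` eventually (LANDED as `stub_trialBound`).  Conclusion: if `RigidFor P` fails
then for some `(R, ε)` there is a sequence of `1/3`-separated sets `S_k ∋ 0` (recentred thinned
near-minimisers), NONE root-matched at `(R, ε)`, whose local slack vanishes: for every `L`, `η > 0`,
eventually every point `s ∈ S_k ∩ B̄_L` has `F(star(s)) ≤ η` and `U(dist s s') ≤ η` for all
`s' ∈ S_k ∩ B̄_L ∖ {s}`.  Proof: (i) TOTAL SLACK for injective `x`: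
`Σ_i F(star_i) + Σ_{i<j} U(r_ij) ≤ 𝓔(x) + N(c + f(0)/2) = 𝓔(x) − N e(P)` (split termwise at
`r_ij > 0`, Bochner form with `w ≡ 1`: `N f(0) + 2Σ_{i<j} f ≥ 0`, `two_mul_interactionEnergy_eq_sum_sum_sub`);
in particular `E(N) ≥ N e(P)` and `e(P) ≤ E(2)/2 < 0`; (ii) along the bad sequence
(`¬ RigidFor`: `R, ε, x` injective with excess `o(N)` and, frequently, `≥ θN` bad particles) the
slack is `≤ excess + (E(N) − N e(P)) = o(N)` by the trial bound; (iii) thin each `x N` (Stub 2):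
`k_N ≤ excess/K = o(N)` deletions, slack does not increase (`e(P) < 0`), and
`#bad_{R,ε}(x) ≤ #bad_{R,ε}(y) + k_N (1 + C(R))` (`C(R)` = packing bound for `1/3`-separated points
in a ball, `card_le_of_separated_of_dist_le`; a particle of `y` with no deleted particle within `R`
is good in `x` iff good in `y`), so frequently `#bad(y) ≥ θN/2`; (iv) DOUBLE COUNTING: with
`τ_j = F(star_j) + Σ_{k≠j} U(r_jk) ≥ 0`, `Σ_j τ_j ≤ 2·slack` and
`Σ_i Σ_{j ∈ B_L(y_i)} τ_j ≤ C(L)·2·slack`, so `#{i : σ_i^L > η} = o(N)`; (v) DIAGONAL choice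
`L_N ↑ ∞`, `η_N ↓ 0` and a bad root `i_N` with `σ^{L_N}_{i_N} ≤ η_N`; `S_k :=` the recentred thinned
configuration at the root (`Good ↔` root-matched, verbatim). Energy is load-bearing exactly here
(`not_rigidForWithoutEnergy`). [cite: FlatleyTheil2015 (finebound shape); BlancLewin2015 §2] -/
theorem stub_rooting :
    (∃ K : ℝ, 0 < K ∧ ∀ (N : ℕ) (x : Fin N → E3), Function.Injective x →
      ∃ (M : ℕ) (y : Fin M → E3), Function.Injective y ∧ Set.range y ⊆ Set.range x ∧
        (∀ i j : Fin M, i ≠ j → (1 / 3 : ℝ) ≤ dist (y i) (y j)) ∧ M ≤ N ∧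
        K * ((N : ℝ) - M) ≤ interactionEnergy lennardJones x - groundStateEnergy lennardJones 3 N ∧
        interactionEnergy lennardJones y ≤ interactionEnergy lennardJones x) →
    ∀ (P : PeriodicConfiguration 3) (c ρ' : ℝ) (g U f : ℝ → ℝ) (F : Set E3 → ℝ),
      (∀ r : ℝ, 0 < r → lennardJones r = g r + U r + f r) →
      (∀ r : ℝ, 0 < r → 0 ≤ U r) →
      (∀ (n : ℕ) (y : Fin n → E3) (w : Fin n → ℝ),
        0 ≤ ∑ i, ∑ j, w i * w j * f (dist (y i) (y j))) →
      (∀ T : Set E3, 0 ≤ F T) →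
      (∀ (N : ℕ) (x : Fin N → E3), Function.Injective x →
        ∑ i, F (((fun z => z - x i) '' Set.range x) ∩ Metric.closedBall 0 ρ') ≤
          interactionEnergy g x + c * N) →
      c + f 0 / 2 = -(P.energyPerParticle lennardJones) →
      (∀ η : ℝ, 0 < η → ∃ N₀ : ℕ, ∀ N : ℕ, N₀ ≤ N →
        groundStateEnergy lennardJones 3 N ≤ (N : ℝ) * (P.energyPerParticle lennardJones + η)) →
      ¬ RigidFor P →
      ∃ (R ε : ℝ), 0 < R ∧ 0 < ε ∧ ∃ S : ℕ → Set E3,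
        (∀ k, ∀ p ∈ S k, ∀ q ∈ S k, p ≠ q → (1 / 3 : ℝ) ≤ dist p q) ∧
        (∀ k, (0 : E3) ∈ S k) ∧
        (∀ k, ¬ ∃ A : E3 →ₗᵢ[ℝ] E3,
          (∀ p ∈ P.points, ‖p‖ ≤ R → ∃ q ∈ S k, dist q (A p) ≤ ε) ∧
          (∀ q ∈ S k, ‖q‖ ≤ R → ∃ p ∈ P.points, dist q (A p) ≤ ε)) ∧
        (∀ L η : ℝ, 0 < η → ∀ᶠ k in Filter.atTop, ∀ s ∈ S k, ‖s‖ ≤ L →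
          F (((fun z => z - s) '' S k) ∩ Metric.closedBall 0 ρ') ≤ η ∧
          ∀ s' ∈ S k, s' ≠ s → ‖s'‖ ≤ L → U (dist s s') ≤ η) :=
  Summit.AtomisticToContinuum.Crystallization.Theorems.CLayerWitnessRooting.stub_rooting

/-- **Stub 4 — the local limit is zero-slack and unmatched (M–L; deterministic, no Palm theory).**
A sequence of `1/3`-separated rooted sets `S_k ∋ 0`, none root-matched at `(R, ε)`, with vanishing
local `(F,U)`-slack (Stub 3's output), has — for `U ≥ 0` continuous on `(0,∞)`, `F ≥ 0` uniformly
continuous in the local matching topology on separated rooted sets — a local limit `Y` that is a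
ZERO-SLACK SET: `1/3`-separated, `0 ∈ Y`, every recentred `ρ'`-star `F`-tight, every pair distance a
zero of `U`; and `Y` is not root-matched at `(R + 1, ε/2)`.  Proof: the tree's sequential
compactness `exists_subseq_forall_eventually_ballMatch` (δ = 1/3) gives `φ`, `Y` (`1/3`-separated)
with `BallMatch η R' 0 (S_{φ k}) Y` eventually for all `R', η > 0`; `0 ∈ Y` (the matched partners of
`0` are eventually one fixed point of norm `→ 0`); for `y ∈ Y` and partners `s_k → y`, the recentred
sets `S_{φ k} − s_k → Y − y` in the matching topology at radius `ρ' + 1`, `F(star(s_k)) → 0`, so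
`F(star_Y(y)) = 0` by the continuity clause and `F ≥ 0`; for `y ≠ y'` the partner distances converge
to `dist y y' ≥ 1/3 > 0` and `0 ≤ U(dist s_k s_k') → 0`, so `U(dist y y') = 0` by continuity; finally a
root-matching of `Y` at `(R + 1, ε/2)` by `A` would, through an `ε/2`-matching at radius `≥ R + 1`,
root-match `S_{φ k}` at `(R, ε)` — excluded. [cite: BaakeGrimm2013 Rem. 5.6 (local rubber topology); folklore] -/
theorem stub_localLimit :
    ∀ (P : PeriodicConfiguration 3) (ρ' R ε : ℝ) (U : ℝ → ℝ) (F : Set E3 → ℝ) (S : ℕ → Set E3),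
      0 < ε →
      (∀ r : ℝ, 0 < r → 0 ≤ U r) → ContinuousOn U (Set.Ioi 0) → (∀ T : Set E3, 0 ≤ F T) →
      (∀ ε' : ℝ, 0 < ε' → ∃ η : ℝ, 0 < η ∧ ∀ S' T : Set E3,
        (∀ p ∈ S', ∀ q ∈ S', p ≠ q → (1 / 3 : ℝ) ≤ dist p q) →
        (∀ p ∈ T, ∀ q ∈ T, p ≠ q → (1 / 3 : ℝ) ≤ dist p q) →
        (0 : E3) ∈ S' → (0 : E3) ∈ T → BallMatch η (ρ' + 1) 0 S' T →
        |F (S' ∩ Metric.closedBall 0 ρ') - F (T ∩ Metric.closedBall 0 ρ')| ≤ ε') →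
      (∀ k, ∀ p ∈ S k, ∀ q ∈ S k, p ≠ q → (1 / 3 : ℝ) ≤ dist p q) →
      (∀ k, (0 : E3) ∈ S k) →
      (∀ k, ¬ ∃ A : E3 →ₗᵢ[ℝ] E3,
        (∀ p ∈ P.points, ‖p‖ ≤ R → ∃ q ∈ S k, dist q (A p) ≤ ε) ∧
        (∀ q ∈ S k, ‖q‖ ≤ R → ∃ p ∈ P.points, dist q (A p) ≤ ε)) →
      (∀ L η : ℝ, 0 < η → ∀ᶠ k in Filter.atTop, ∀ s ∈ S k, ‖s‖ ≤ L →
        F (((fun z => z - s) '' S k) ∩ Metric.closedBall 0 ρ') ≤ η ∧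
        ∀ s' ∈ S k, s' ≠ s → ‖s'‖ ≤ L → U (dist s s') ≤ η) →
      ∃ Y : Set E3,
        (∀ p ∈ Y, ∀ q ∈ Y, p ≠ q → (1 / 3 : ℝ) ≤ dist p q) ∧ (0 : E3) ∈ Y ∧
        (∀ y ∈ Y, F (((fun z => z - y) '' Y) ∩ Metric.closedBall 0 ρ') = 0) ∧
        (∀ y ∈ Y, ∀ y' ∈ Y, y ≠ y' → U (dist y y') = 0) ∧
        ¬ ∃ A : E3 →ₗᵢ[ℝ] E3,
          (∀ p ∈ P.points, ‖p‖ ≤ R + 1 → ∃ q ∈ Y, dist q (A p) ≤ ε / 2) ∧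
          (∀ q ∈ Y, ‖q‖ ≤ R + 1 → ∃ p ∈ P.points, dist q (A p) ≤ ε / 2) :=
  Summit.AtomisticToContinuum.Crystallization.Theorems.CLayerWitnessLocalLimit.stub_localLimit

/-- **Stub 5a — layering OFF the ideal ratio: exact Barlow 13-stars everywhere ⇒ a global Barlow
stacking (M–L; potential-free geometry).**  For `h/a ∈ (0.775, 0.894)` the ball `B̄_{6a/5}` of a
Barlow stacking `barlowStacking a h s` about a site contains exactly the site and its 12 neighbours
(6 in-plane at `a`, 3 + 3 in the adjacent layers at `b = √(a²/3 + h²) ∈ (0.966a, 1.065a)`; the next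
distances `√(4a²/3 + h²) ≥ 1.39a`, `2h ≥ 1.55a` are outside), in the h-pattern (`s(−1) ≠ s 0`) or
the c-pattern (`s(−1) = s 0`).  CLAIM (off the ideal ratio `h² ≠ 2a²/3`, i.e. `b ≠ a`): a set
`Y ∋ 0` every point of which sees, within `6a/5`, a linearly rotated copy of such a 13-point star
is ONE linearly rotated Barlow stacking `A '' barlowStacking a h s` (`s` Hägg, `barlowPos s 0 0 0 = 0`).
Proof (lead's vetting, NOTES.md §Vetting): WLOG the star of `0` is the standard one (replace `Y`
by `B₀⁻¹ '' Y`).  IN-LAYER PROPAGATION: for a point `p` of the triangular lattice `Λ₀ = ℤu + ℤv`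
already known to lie in `Y` with `{y ∈ Y : dist y p = a} = p + H` (`H` = the six in-plane
neighbours; off the ideal ratio the points at distance EXACTLY `a` are the hexagon, since `b ≠ a`),
each neighbour `q = p + e` lies in `Y`, and `Y ∩ sphere(q, a)` is a linearly rotated regular hexagon
`B_q '' H` containing `−e` and `e' − e` for a common neighbour `p + e'` (`e·e' = a²/2`); a rotated
copy of `H` containing two elements `x₁, x₂` of `H` with `x₁·x₂ = a²/2` IS `H`
(`H = {±x₁, ±x₂, ±(x₁ − x₂)}` — a 36-case identity), so `{y ∈ Y : dist y q = a} = q + H`; induction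
over `ℤ²` gives `Λ₀ ⊆ Y` with standard hexagons everywhere.  VERTICAL STRUCTURE: a non-hexagon star
point `z` of `p ∈ Λ₀` is at distance `b` from `p` and from exactly two ADJACENT hexagon points
`p + e₁, p + e₂` (isometry-invariant fact of the standard star), hence `z = p + (e₁+e₂)/3 ± h e₃`
(circumcentre line of the side-`a` triangle); the six such points split into two side-`a` triangles
(distance-`a` graph of the standard star), each a full hole class `±{w, w−u, w−v}` at one height, and
at opposite heights (same height would put two of them at distance `2a/√3 < 2h ≤` the standard
cross-distance); consistency of the hole class along lattice edges (a hole point over `p` within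
`6a/5` of `q = p + u` must be a hole point of the same class over `q`) makes the upper class `τ₊`
and the lower class `τ₋` constant on `Λ₀`; so `Y ∩ {x₃ = ±h} ⊇ Λ₀ ± h e₃ + τ_± w` and, by the
covering radius `a/√3` of `Λ₀` and `h < 1.052a`, `Y ∩ {0 < |x₃| < 2h − …}` is exactly these two layers;
induction upward and downward over layers gives `Y = ⋃_k (Λ₀ + L_k w + k h e₃)` with
`L_{k+1} − L_k = ±1`, i.e. `Y = barlowStacking a h s` for the Hägg sequence of signs. [cite: HalesDSP2012 §1.3; Hales2012 Thm 1; ConwaySloane1999 Ch. 1 §1.3] -/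
theorem stub_layeringOffIdeal :
    ∀ (a h : ℝ), 0 < a → 0 < h → 0.775 * a < h → h < 0.894 * a → h ^ 2 ≠ 2 * a ^ 2 / 3 →
    ∀ Y : Set E3, (0 : E3) ∈ Y →
      (∀ y ∈ Y, ∃ s : ℤ → ℤ, IsHaggSeq s ∧ ∃ B : E3 →ₗᵢ[ℝ] E3,
        ((fun z => z - y) '' Y) ∩ Metric.closedBall 0 (6 * a / 5) =
          B '' (barlowStacking a h s ∩ Metric.closedBall 0 (6 * a / 5))) →
      ∃ s : ℤ → ℤ, IsHaggSeq s ∧ ∃ A : E3 →ₗᵢ[ℝ] E3, Y = A '' barlowStacking a h s := by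
  sorry

/-- **Stub 5b — layering AT the ideal ratio `h = a√(2/3)` (M; reduction to the PROVED tree theorem
`HalesDSP_layerPackings_holds`, Hales *Dense Sphere Packings* §1.3).**  At the ideal ratio all twelve
neighbours are at distance `a`, the 13-point `6a/5`-stars are the FCC (c) / HCP (h) kissing patterns,
and the claim is Hales's layer theorem after scaling: `V := (2/a) • Y` is a packing of unit balls
(two points of `Y` at distance `< 6a/5` lie in a common star, whose non-zero points have norm `a`:
in-plane `≥ a`, adjacent layers `√(a²/3 + h²) = a`, so `dist ≥ a`), every kissing shell
`kissingShell V u = B_y '' kissingShell (barlowStacking 2 (2√(2/3)) s_y) 0` (scaling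
`barlowPos (c a) (c h) s = c • barlowPos a h s`) is an FCC/HCP pattern
(`kissingShell_barlowStacking_eq_layerShell` at `(k,i,j) = (0,0,0)` + `isArrangedIn_layerShell_fcc'/hcp'`,
`IsArrangedIn` being invariant under the linear isometry `B_y`), so
`V = g '' barlowStacking 2 (2√(2/3)) s` for an isometry `g = (p₀ + L ·)` (`HalesDSP_layerPackings_holds`);
RE-ROOTING: `0 ∈ V` is `g x₀` with `x₀ = barlowPos s k i j`, and
`barlowStacking a h s − barlowPos s k i j = barlowStacking a h (s ∘ (· + k))` (labels
`L_{n+k} − L_k`, in-layer part absorbed by `Λ₀`), so `V = L '' barlowStacking 2 (2√(2/3)) s'` with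
`s' = s ∘ (· + k)` Hägg and `L` LINEAR; unscale. [cite: HalesDSP2012 §1.3; Hales2012 Thm 1] -/
theorem stub_layeringIdeal :
    ∀ (a h : ℝ), 0 < a → 0 < h → h ^ 2 = 2 * a ^ 2 / 3 →
    ∀ Y : Set E3, (0 : E3) ∈ Y →
      (∀ y ∈ Y, ∃ s : ℤ → ℤ, IsHaggSeq s ∧ ∃ B : E3 →ₗᵢ[ℝ] E3,
        ((fun z => z - y) '' Y) ∩ Metric.closedBall 0 (6 * a / 5) =
          B '' (barlowStacking a h s ∩ Metric.closedBall 0 (6 * a / 5))) →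
      ∃ s : ℤ → ℤ, IsHaggSeq s ∧ ∃ A : E3 →ₗᵢ[ℝ] E3, Y = A '' barlowStacking a h s := by
  sorry

/-- **Layering on the whole window** (Stubs 5a + 5b by cases on `h² = 2a²/3`): exact Barlow
13-stars everywhere ⇒ one linearly rotated Barlow stacking. [cite: HalesDSP2012 §1.3] -/
theorem layering_of_stubs :
    ∀ (a h : ℝ), 0 < a → 0 < h → 0.775 * a < h → h < 0.894 * a →
    ∀ Y : Set E3, (0 : E3) ∈ Y →
      (∀ y ∈ Y, ∃ s : ℤ → ℤ, IsHaggSeq s ∧ ∃ B : E3 →ₗᵢ[ℝ] E3,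
        ((fun z => z - y) '' Y) ∩ Metric.closedBall 0 (6 * a / 5) =
          B '' (barlowStacking a h s ∩ Metric.closedBall 0 (6 * a / 5))) →
      ∃ s : ℤ → ℤ, IsHaggSeq s ∧ ∃ A : E3 →ₗᵢ[ℝ] E3, Y = A '' barlowStacking a h s := by
  intro a h ha hh hw1 hw2 Y hY0 hloc
  by_cases hid : h ^ 2 = 2 * a ^ 2 / 3
  · exact stub_layeringIdeal a h ha hh hid Y hY0 hloc
  · exact stub_layeringOffIdeal a h ha hh hw1 hw2 hid Y hY0 hloc

/-- **Stub 6 — the c-layer witness selects hcp (M; Barlow arithmetic, no energetics, no `J_k`).**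
If a Barlow stacking `barlowStacking a h s` (`a, h > 0`, `s` Hägg, ANY ratio) realises the squared
distance `16a²/3 + 4h²` between NO two of its points, then it is `hcpStacking a h` up to a linear
isometry (the identity or the half-turn about `e₃`).  Proof: (i) a cubic letter `s m = s (m+1)`
gives label difference `haggLabel s (m+2) − haggLabel s m = ±2`, and by `dist_barlowPos_sq` the points
`barlowPos s m i j`, `barlowPos s (m+2) (i ± 2) (j ∓ 2)` (signs with the letter) are at squared
distance `a²·[(Δi + Δj/2 ∓ 1)² + ¾(Δj ∓ 2/3)²] + 4h² = 16a²/3 + 4h²` (`(X,Y) = (−1,2)` in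
`X² + XY + Y² + Y + 1/3 = 16/3`, triage r1-2); so the hypothesis forces `s (m+1) = −s m` for all
`m`, i.e. `s = alternatingHagg` or `s = −alternatingHagg` (`IsHaggSeq`, integer induction from
`s 0 = ±1`); (ii) `barlowStacking a h alternatingHagg = hcpStacking a h` by definition, and for
`s = −alternatingHagg` the labels are `0, −1, 0, −1, …`, so
`barlowPos s k i j = halfTurn (barlowPos alternatingHagg k (−i) (−j))` with the half-turn
`(v₀,v₁,v₂) ↦ (−v₀,−v₁,v₂)` (a linear isometry; `Disproof.halfTurn`, `HcpHomogeneous.lean`).  This is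
the forward half of the card's `cLayerWitness_iff`; the converse (hcp never realises the distance on
the window) is what makes (S2) consistent with exactness and is not needed here.
[cite: ConwaySloane1999 Ch. 1 §1.3; PartayOrtnerCsanyi2017 App. A; HalesDSP2012 §1.3] -/
theorem stub_witness :
    ∀ (a h : ℝ), 0 < a → 0 < h → ∀ s : ℤ → ℤ, IsHaggSeq s →
      (∀ x ∈ barlowStacking a h s, ∀ y ∈ barlowStacking a h s,
        dist x y ^ 2 ≠ 16 * a ^ 2 / 3 + 4 * h ^ 2) →
      ∃ B : E3 →ₗᵢ[ℝ] E3, barlowStacking a h s = B '' hcpStacking a h :=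
  Summit.AtomisticToContinuum.Crystallization.Theorems.CLayerWitnessWitness.stub_witness

/-! ## Proved remarks -/

/-- The strict star certificate contains the route's crux `ExactCertificate` (stmt-11959) at
`P = hcp(a,h)`: `g`-stability follows from `F ≥ 0` and the star inequality.  (Documents that Stub 1
is crux 11959 STRENGTHENED — the card's declared transfer — and nothing else.) [folklore] -/
theorem exactCertificate_of_strictCertificate : ExactCertificate := by
  obtain ⟨a, h, ha, hh, -, -, ρ, c, ρ', g, U, f, F, hsplit, hU0, -, hg0, hf, hF0, hstar, -, -, -, hid⟩ :=
    stub_strictCertificate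
  refine ⟨hcpPeriodicConfiguration ha.ne' hh.ne', ρ, c, g, U, f, hsplit, hU0, hg0, hf, ?_, hid⟩
  intro N x hx
  have h1 := hstar N x hx
  have h2 : 0 ≤ ∑ i, F (((fun z => z - x i) '' Set.range x) ∩ Metric.closedBall 0 ρ') :=
    Finset.sum_nonneg fun i _ => hF0 _
  linarith

/-- Translation preserves `1/3`-separation (used to feed (S1) with the recentred zero-slack set). [folklore] -/
theorem separated_image_sub {Y : Set E3} {δ : ℝ}
    (hY : ∀ p ∈ Y, ∀ q ∈ Y, p ≠ q → δ ≤ dist p q) (y : E3) :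
    ∀ p ∈ (fun z => z - y) '' Y, ∀ q ∈ (fun z => z - y) '' Y, p ≠ q → δ ≤ dist p q := by
  rintro p ⟨p', hp', rfl⟩ q ⟨q', hq', rfl⟩ hpq
  have hne : p' ≠ q' := fun h => hpq (by rw [h])
  have := hY p' hp' q' hq' hne
  rwa [dist_sub_right]

/-! ## The composition -/

/-- **Composition (kernel-checked; `sorry` only inside the seven stubs).**  `SlackRigidity` BY NAME,
with the witness `P := hcpPeriodicConfiguration` of Stub 1: if `RigidFor P` failed, Stubs 2–3 (with
the landed trial bound) root a small-slack bad sequence, Stub 4 extracts a zero-slack local limit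
`Y ∋ 0` unmatched at its root, (S1) + Stub 5 make `Y` a rotated Barlow stacking with the
certificate's `(a,h)`, `U = 0` on its distances and (S2) exclude the witness distance, Stub 6 makes
it rotated hcp — which IS matched at the root (tolerance `0 ≤ ε/2`): contradiction. -/
theorem SlackRigidity_of : SlackRigidity := by
  classical
  obtain ⟨a, h, ha, hh, hw1, hw2, ρ, c, ρ', g, U, f, F, hsplit, hU0, hUc, hg0, hf, hF0, hstar, hcont,
    hS1, hS2, hid⟩ := stub_strictCertificate
  rw [slackRigidity_iff]
  refine ⟨hcpPeriodicConfiguration ha.ne' hh.ne', ?_⟩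
  by_contra hrig
  -- Stubs 2, 3 and the landed trial-state bound: a rooted small-slack bad sequence
  obtain ⟨R, ε, hR, hε, S, hsep, h0, hbad, hsmall⟩ :=
    stub_rooting stub_thinning (hcpPeriodicConfiguration ha.ne' hh.ne') c ρ' g U f F hsplit hU0 hf
      hF0 hstar hid (stub_trialBound (hcpPeriodicConfiguration ha.ne' hh.ne')) hrig
  -- Stub 4: a zero-slack local limit, unmatched at the root
  obtain ⟨Y, hYsep, hY0, hYF, hYU, hYbad⟩ :=
    stub_localLimit (hcpPeriodicConfiguration ha.ne' hh.ne') ρ' R ε U F S hε hU0 hUc hF0 hcont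
      hsep h0 hbad hsmall
  -- (S1): every star of `Y` is a rotated Barlow 12-star of `hcp(a,h)` geometry
  have hloc : ∀ y ∈ Y, ∃ s : ℤ → ℤ, IsHaggSeq s ∧ ∃ B : E3 →ₗᵢ[ℝ] E3,
      ((fun z => z - y) '' Y) ∩ Metric.closedBall 0 (6 * a / 5) =
        B '' (barlowStacking a h s ∩ Metric.closedBall 0 (6 * a / 5)) := by
    intro y hy
    exact hS1 ((fun z => z - y) '' Y) (separated_image_sub hYsep y) ⟨y, hy, sub_self y⟩ (hYF y hy)
  -- Stub 5: `Y` is one rotated Barlow stacking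
  obtain ⟨s, hs, A, hYeq⟩ := layering_of_stubs a h ha hh hw1 hw2 Y hY0 hloc
  -- (S2) and `U`-tightness of `Y`: the witness distance is not realised by the stacking
  have hnot : ∀ x ∈ barlowStacking a h s, ∀ y ∈ barlowStacking a h s,
      dist x y ^ 2 ≠ 16 * a ^ 2 / 3 + 4 * h ^ 2 := by
    intro x hx y hy heq
    have hpos : 0 < 16 * a ^ 2 / 3 + 4 * h ^ 2 := by positivity
    have hxy : x ≠ y := by
      rintro rfl
      rw [dist_self] at heq
      have h00 : (0 : ℝ) ^ 2 = 0 := by norm_num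
      rw [h00] at heq
      linarith
    have hAx : A x ∈ Y := by rw [hYeq]; exact ⟨x, hx, rfl⟩
    have hAy : A y ∈ Y := by rw [hYeq]; exact ⟨y, hy, rfl⟩
    have hAne : A x ≠ A y := fun h' => hxy (A.injective h')
    have hU := hYU (A x) hAx (A y) hAy hAne
    rw [LinearIsometry.dist_map] at hU
    have hd : Real.sqrt (16 * a ^ 2 / 3 + 4 * h ^ 2) = dist x y := by
      rw [← heq, Real.sqrt_sq dist_nonneg]
    rw [← hd] at hU
    exact absurd hU (ne_of_gt hS2)
  -- Stub 6: the stacking is rotated hcp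
  obtain ⟨B, hB⟩ := stub_witness a h ha hh s hs hnot
  -- hence `Y = (A ∘ B) '' P.points` is matched at the root: contradiction
  apply hYbad
  refine ⟨A.comp B, ?_, ?_⟩
  · intro p hp _
    refine ⟨A (B p), ?_, ?_⟩
    · rw [hYeq]
      refine ⟨B p, ?_, rfl⟩
      rw [hB]
      refine ⟨p, ?_, rfl⟩
      rwa [hcpPeriodicConfiguration_points] at hp
    · rw [LinearIsometry.coe_comp, Function.comp_apply, dist_self]
      exact (half_pos hε).le
  · intro q hq _
    rw [hYeq] at hq
    obtain ⟨x, hx, rfl⟩ := hq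
    rw [hB] at hx
    obtain ⟨p, hp, rfl⟩ := hx
    refine ⟨p, ?_, ?_⟩
    · rw [hcpPeriodicConfiguration_points]; exact hp
    · rw [LinearIsometry.coe_comp, Function.comp_apply, dist_self]
      exact (half_pos hε).le

end Summit.AtomisticToContinuum.Crystallization.Cruxes.SlackRigidity.CLayerWitnessStrictness

end
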